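import Mathlib
import Summits.AtomisticToContinuum.Crystallization.Theses.ExcessDecayLiouville
import Summits.AtomisticToContinuum.Crystallization.Theorems.PhononStability.Negative.Mirror
import Summits.AtomisticToContinuum.Crystallization.Theorems.PhononStability.Negative.WithoutAdm
import Summits.AtomisticToContinuum.Crystallization.Theorems.PhononStability.Negative.WithoutInner

/-!
# Line `fourier-free-sos-certificate` — skeleton for crux `PhononStability` (stmt-AtomisticToContinuum-9333)

Route `ExcessDecayLiouville`, crux rank 4 (uniform harmonic stability of Lennard-Jones over the
admissible affine-hcp window).  Idea card `Cruxes/PhononStability/Ideas/fourier-free-sos-certificate.md`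
(merged by triage with `star-gram-null-lagrangian`; `cellwise-polyconvex-certificate` is its
block-sparse validated instance).  Line card: `Lines/fourier-free-sos-certificate.md`.

THE LINE.  Pull the typed inequality back to LABEL space `Fin 2 × ℤ³` (sublattice × cell), split the
second variation by a FIXED LABEL STENCIL `nearStencil` (all label bonds of reference hcp length
`≤ 3`, 316 directed elements; the split is by label, so it is constant over the window), and prove

* `stub_cert`   (XL, the bet): at every admissible datum `(t, A)` with `A` symmetric positive, the
  DISCOUNTED FINITE-RANGE operator `Q = near − ¼·bar − κ·strain` is a GRAM SUM OF SQUARES OF FINITE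
  DIFFERENCES with stencil `nearStencil` (`SOSRep`: `Q w = Σ_p c(p)ᵀ X c(p)`, `X ⪰ 0` as a quadratic
  form, `c(p)` = the stencil differences of `w` at cell `p`), for some level `κ > 1/50`;
* `stub_tail`   (L–XL): the far field (label bonds outside the stencil, all with `V″ < 0 < V′/r`)
  is bounded below in the RIGIDITY CURRENCY: `−¼·bar − (1/50)·strain ≤ far` on the whole window
  (`bar` = NN longitudinal form, `strain` = NN strain form, ordered-pair normalisation as typed);
* `stub_polar`  (M–L): polar normal form — certificates on the symmetric-positive window give
  certificates on the whole window (O(3)-covariance of `SOSRep`, polar decomposition of the invertible cell);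
* `stub_transfer` (L): soundness — label bijection `Label ≃ Sites t A`, re-indexing and summability
  of the typed `tsum`s for finitely supported `u`, NN bond-graph constancy (`dist ≤ 11/10 ↔ NN label
  bond` on the window), `near + far = ½·hessForm`, `sosForm ≥ 0`; any `κ > ε` then gives the crux
  with constant `κ − ε`.

`composition : TransferReduction → PolarReduction → TailBound → CertificateOnSymWindow →
PhononStabilityOn (Adm ∧ Inner)` is modus ponens, and `PhononStability_of : PhononStability` (the ONLY
theorem of the file concluding the crux, BY NAME) feeds the four registered stubs through it and the landed
mirror `phononStability_iff_on`; sorries live only inside `stub_*`.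

CONSTANTS (chosen from the triage tables, all priced at the adversarial window minimum κ* ≈ 0.105 of
Disproof Part V, not at 0.24–0.28): Gram/near stencil = reference radius 3 (`stencil 9`, 316 directed
bonds); tail discount `¼·barForm` in the typed ordered-pair normalisation = `½` off the longitudinal NN
force constant per bond (float optimum needed beyond 3a at the worst datum: 0.15, triage r1-3 §tauR);
additive remainder `1/50·strainForm` for the far-far field (path/Poincaré constant `10/R³+17/R⁴ ≤ 0.02`
from `R ≈ 8–9`); certificate level `κ > 1/50` existential (float PSD level of `near − ¼ bar` at the
worst datum ≈ 0.054).  The lead may retune `(radius, ¼, 1/50)` — they appear only in `stub_tail`,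
`stub_cert` (statements `TailBound`, `CertificateOnSymWindow`) and the two numerals of `composition`;
`TransferReduction`/`PolarReduction` are uniform in
`κ τ ε`.  Enlarging only the GRAM stencil (first argument of `SOSRep`) while keeping `Qform nearStencil`
is the format's one free retry if an SOS gap shows up at radius 3 (`labelBox` is complete for reference
radius `< 5.83`, i.e. `stencil ρ` is exact for `ρ < 34`).

Disproof obligations honoured: both
`phononStability_false_without_Adm` and `phononStability_false_without_Inner` (landed under
`Theorems/PhononStability/Negative/`) — every stub keeps `Adm₀ A` AND `Inner₀ t A` (the label
bijection and the bond-graph constancy in `stub_transfer`, and the bond-length window behind the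
coefficients in `stub_cert`/`stub_tail`, all use both); see the `example`s at the end.
-/

noncomputable section

namespace Summit.AtomisticToContinuum.Crystallization.Cruxes.PhononStability.FourierFreeSosCertificate

open scoped BigOperators InnerProductSpace
open Matrix
open Literature.MathematicalPhysics.StatisticalMechanics
open Summit.AtomisticToContinuum.Crystallization.Theses.ExcessDecayLiouville
open Summit.AtomisticToContinuum.Crystallization.Theorems.PhononStabilityNegative

local notation "E3" => EuclideanSpace ℝ (Fin 3)

/-! ## Labels, stencils, finite differences -/

/-- A site label: sublattice `m : Fin 2` and integer coordinates in the hcp period lattice. -/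
abbrev Label := Fin 2 × (Fin 3 → ℤ)

/-- A stencil element `(m, n, ℓ)`: the directed label bond from `(m, p)` to `(n, p + ℓ)` (any cell `p`). -/
abbrev StencilElem := Fin 2 × Fin 2 × (Fin 3 → ℤ)

/-- Squared length of the stencil element in the REFERENCE hcp two-lattice (spacing `a = 1`, ideal
`c/a`, zero inner displacement): with `s = n − m`, `ℓ = (i, j, k)` the bond vector is
`(i + j/2 + s/2, √3 (j/2 + s/6), √(2/3) (2k + s))`, whose squared norm is rational. -/
def refSqLen (b : StencilElem) : ℚ :=
  let s : ℚ := ((b.2.1 : ℕ) : ℚ) - ((b.1 : ℕ) : ℚ)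
  let i : ℚ := (b.2.2 0 : ℚ)
  let j : ℚ := (b.2.2 1 : ℚ)
  let k : ℚ := (b.2.2 2 : ℚ)
  (i + j / 2 + s / 2) ^ 2 + 3 * (j / 2 + s / 6) ^ 2 + 2 / 3 * (2 * k + s) ^ 2

/-- A box of label offsets containing every label bond of reference length `< 5.83` (squared `< 34`). -/
def labelBox : Finset StencilElem :=
  Finset.univ ×ˢ Finset.univ ×ˢ Fintype.piFinset fun _ : Fin 3 => Finset.Icc (-6 : ℤ) 6

/-- The label stencil of all non-degenerate directed bonds of squared reference length `≤ ρ`. -/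
def stencil (ρ : ℚ) : Finset StencilElem :=
  labelBox.filter fun b => ¬ (b.1 = b.2.1 ∧ b.2.2 = 0) ∧ refSqLen b ≤ ρ

/-- NEAR stencil: reference length `≤ 3` (15 hcp shells, 158 neighbours per origin sublattice,
316 directed elements; Gram matrices live in `Sym(948)`). -/
def nearStencil : Finset StencilElem := stencil 9

/-- NN stencil: the 24 directed nearest-neighbour label bonds (12 per origin sublattice: 6 in-plane,
3 up, 3 down).  On the admissible window these are EXACTLY the pairs at actual distance `≤ 11/10`
(NN lengths `∈ [0.92, 1.02]`, second shell `≥ 1.28`) — proved inside `stub_transfer`. -/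
def nnStencil : Finset StencilElem := stencil 1

/-- The period-lattice vector with integer coordinates `z` (the crux's `Λ`, parametrised). -/
def latVec (z : Fin 3 → ℤ) : E3 :=
  (z 0 : ℝ) • triangularVec₁ 1 + (z 1 : ℝ) • triangularVec₂ 1 +
    (z 2 : ℝ) • layerNormal (2 * Real.sqrt (2 / 3))

/-- Actual position of label `a` at datum `(t, A)`; its range is `Sites₀ t A`, bijectively on the window. -/
def sitePos (t : Fin 2 → E3) (A : E3 →L[ℝ] E3) (a : Label) : E3 :=
  t a.1 + A (latVec a.2)

/-- Actual bond vector of stencil element `b = (m, n, ℓ)` at datum `(t, A)` (independent of the cell). -/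
def bondVec (t : Fin 2 → E3) (A : E3 →L[ℝ] E3) (b : StencilElem) : E3 :=
  sitePos t A (b.2.1, b.2.2) - sitePos t A (b.1, 0)

/-- The finite difference of a label field along stencil element `b` at cell `p`. -/
def sdiff (b : StencilElem) (w : Label → E3) (p : Fin 3 → ℤ) : E3 :=
  w (b.2.1, p + b.2.2) - w (b.1, p)

/-! ## The forms (ordered-pair normalisation, exactly as typed in the crux) -/

/-- NEAR part of half the second variation: `½ Σ_p Σ_{b ∈ S} Hess₀(e_b)(Δ_b w(p))`. -/
def nearForm (S : Finset StencilElem) (t : Fin 2 → E3) (A : E3 →L[ℝ] E3) (w : Label → E3) : ℝ :=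
  (∑' p : Fin 3 → ℤ, ∑ b ∈ S, Hess₀ (bondVec t A b) (sdiff b w p)) / 2

/-- FAR part: all label bonds outside `S` (degenerate ones contribute `0`). -/
def farForm (S : Finset StencilElem) (t : Fin 2 → E3) (A : E3 →L[ℝ] E3) (w : Label → E3) : ℝ :=
  (∑' p : Fin 3 → ℤ, ∑' b : StencilElem, if b ∉ S then Hess₀ (bondVec t A b) (sdiff b w p) else 0) / 2

/-- NN STRAIN form `Σ_p Σ_{b ∈ S₁} ‖Δ_b w(p)‖²` (the typed left-hand side, pulled back). -/
def strainForm (S₁ : Finset StencilElem) (w : Label → E3) : ℝ :=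
  ∑' p : Fin 3 → ℤ, ∑ b ∈ S₁, ‖sdiff b w p‖ ^ 2

/-- NN BAR (longitudinal) form `Σ_p Σ_{b ∈ S₁} (ê_b · Δ_b w(p))²` — the rigidity currency of the tail. -/
def barForm (S₁ : Finset StencilElem) (t : Fin 2 → E3) (A : E3 →L[ℝ] E3) (w : Label → E3) : ℝ :=
  ∑' p : Fin 3 → ℤ, ∑ b ∈ S₁, (inner ℝ (bondVec t A b) (sdiff b w p) / ‖bondVec t A b‖) ^ 2

/-- The DISCOUNTED FINITE-RANGE OPERATOR certified by the line: `near − τ·bar − κ·strain`. -/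
def Qform (S S₁ : Finset StencilElem) (κ τ : ℝ) (t : Fin 2 → E3) (A : E3 →L[ℝ] E3)
    (w : Label → E3) : ℝ :=
  nearForm S t A w - τ * barForm S₁ t A w - κ * strainForm S₁ w

/-! ## Gram / sum-of-squares certificates of finite differences -/

/-- Coordinates of the stencil differences of `w` at cell `p`: the vector `c(p) ∈ ℝ^{S × 3}`. -/
def coordVec (S : Finset StencilElem) (w : Label → E3) (p : Fin 3 → ℤ) : (↥S × Fin 3) → ℝ :=
  fun bi => (sdiff bi.1.1 w p) bi.2

/-- Gram (sum-of-squares-of-differences) form of a scalar block matrix `X` over the stencil `S`: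
`Σ_p c(p)ᵀ X c(p)`. -/
def sosForm (S : Finset StencilElem) (X : Matrix (↥S × Fin 3) (↥S × Fin 3) ℝ) (w : Label → E3) : ℝ :=
  ∑' p : Fin 3 → ℤ, coordVec S w p ⬝ᵥ (X *ᵥ coordVec S w p)

/-- Positive semidefiniteness of the Gram matrix as a quadratic form (in practice: `X = Lᵀ L`
syntactically over `ℚ`; `Matrix.PosSemidef X` implies it). -/
def GramPSD (S : Finset StencilElem) (X : Matrix (↥S × Fin 3) (↥S × Fin 3) ℝ) : Prop :=
  ∀ c : (↥S × Fin 3) → ℝ, 0 ≤ c ⬝ᵥ (X *ᵥ c)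

/-- `Q` is a Gram sum of squares of finite differences with stencil `S` (on finitely supported
fields).  Strictly stronger than `Q ≥ 0`; decidable by ring arithmetic on a coefficient-kernel
identity once `X` is rational; convex in `Q` and monotone under adding bond terms with PSD blocks. -/
def SOSRep (S : Finset StencilElem) (Q : (Label → E3) → ℝ) : Prop :=
  ∃ X : Matrix (↥S × Fin 3) (↥S × Fin 3) ℝ, GramPSD S X ∧
    ∀ w : Label → E3, (Function.support w).Finite → Q w = sosForm S X w

/-- Symmetric positive cells (polar normal form of the window: `A = P = √(AᵀA)`). -/
def SymPos (A : E3 →L[ℝ] E3) : Prop :=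
  (∀ x y : E3, inner ℝ (A x) y = inner ℝ x (A y)) ∧ ∀ x : E3, 0 ≤ inner ℝ (A x) x

/-! ## Sanity of the stencils (decided by kernel evaluation: 12+12 nearest neighbours; 158+158 neighbours
within reference distance 3 — the hcp shells 12, 6, 2, 18, 12, 6, 12, 12, 6, 6, 12, 24, 6, 12, 12 of
`ConwaySloane1999_hcpShells`) -/

example : nnStencil.card = 24 := by decide +kernel
example : nearStencil.card = 316 := by decide +kernel

/-! ## The four stub STATEMENTS (named `Prop`s; the registered stubs below assert exactly these) -/

/-- **S1 — TRANSFER / soundness of the label-space certificate format (size L).**  For any level `κ`,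
discount `τ` and tail allowance `ε < κ`: pointwise SOS-representability of the discounted
finite-range operator on the window, plus the far-field bound in the rigidity currency, give the
crux inequality with constant `κ − ε` on the window `Adm ∧ Inner`.  Content: `sitePos t A` is a
bijection `Label → Sites₀ t A` (needs `Adm₀`: `σ_min(A) ≥ 0.97 − 1/40 > 0`, and `Inner₀`: sites of
different sublattices are `≥ 0.945·1 − 1/40 = 0.92` apart, since `w₀ + √(2/3)e₃ + Λ` stays at distance
`≥ 1` from `0`); the typed double `tsum`s re-index to `Σ_p Σ_b` and are
summable for finitely supported `u` (`|Hess₀ e w| ≤ 904‖e‖⁻⁸‖w‖²`, `abs_Hess₀_le_inv_pow`, and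
lattice counting); `½·hessForm = nearForm + farForm`; on the window `dist ≤ 11/10 ↔ b ∈ nnStencil`
so `nnForm = strainForm nnStencil`; `sosForm ≥ 0` termwise from `GramPSD`; chain
`½ hessForm ≥ near − τ bar − ε strain = Q + (κ − ε) strain ≥ (κ − ε)·nnForm`. -/
def TransferReduction : Prop :=
  ∀ κ τ ε : ℝ, ε < κ →
    (∀ (t : Fin 2 → E3) (A : E3 →L[ℝ] E3), Adm₀ A → Inner₀ t A →
        SOSRep nearStencil (Qform nearStencil nnStencil κ τ t A)) →
    (∀ (t : Fin 2 → E3) (A : E3 →L[ℝ] E3), Adm₀ A → Inner₀ t A →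
        ∀ w : Label → E3, (Function.support w).Finite →
          -(τ * barForm nnStencil t A w) - ε * strainForm nnStencil w ≤ farForm nearStencil t A w) →
    PhononStabilityOn fun t A => Adm₀ A ∧ Inner₀ t A

/-- **S2 — POLAR NORMAL FORM of the window (size M–L).**  SOS-representability of the discounted
operator at every SYMMETRIC POSITIVE admissible datum implies it at every admissible datum.
Content: polar decomposition `A = O P` in `E3 →L[ℝ] E3` (`A` is invertible on the window; `O` a
linear isometry, `P = √(AᵀA)` symmetric positive via `LinearMap.IsSymmetric.eigenvectorBasis`);
`Adm₀ P` with the isometry `O⁻¹ R` (`‖P − 0.97·O⁻¹R‖ = ‖A − 0.97·R‖`), `Inner₀ (O⁻¹ ∘ t) P` by norm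
invariance, and O(3)-covariance of every form: `bondVec (O⁻¹∘t) P b = O⁻¹ (bondVec t A b)`,
`Hess₀ (O⁻¹ e) (O⁻¹ v) = Hess₀ e v`, hence `Qform … t A w = Qform … (O⁻¹∘t) P (O⁻¹ ∘ w)` and
`sosForm X' (O⁻¹ ∘ w) = sosForm ((1 ⊗ M)ᵀ X' (1 ⊗ M)) w` (`M` = matrix of `O⁻¹`), PSD preserved. -/
def PolarReduction : Prop :=
  ∀ κ τ : ℝ,
    (∀ (t : Fin 2 → E3) (A : E3 →L[ℝ] E3), Adm₀ A → Inner₀ t A → SymPos A →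
        SOSRep nearStencil (Qform nearStencil nnStencil κ τ t A)) →
    ∀ (t : Fin 2 → E3) (A : E3 →L[ℝ] E3), Adm₀ A → Inner₀ t A →
      SOSRep nearStencil (Qform nearStencil nnStencil κ τ t A)

/-- **S3 — THE FAR FIELD IN THE RIGIDITY CURRENCY (size L–XL).**  On the whole window, the part of
half the second variation carried by label bonds of reference length `> 3` (next shell `√(29/3) ≈ 3.11`,
actual `≥ 2.91` on the window) is `≥ −¼·barForm − (1/50)·strainForm` (ordered-pair normalisation:
`¼·bar` = a discount `½` on the longitudinal NN force constant `φ_NN ∈ [3.9, 28]` per bond).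
Content: for `r > 1.109`, `V″(r) = 13r⁻¹⁴ − 7r⁻⁸ < 0 < V′(r)/r`, so dropping the transverse far
terms is monotone and only `Σ_far |V″(r_z)| (ẑ·Δ_z w)²` needs control; for `3 < |z| ≤ R₂` factor each
far elongation through the NN bar elongations of an infinitesimally rigid cluster containing the pair
(it vanishes on the cluster's rigid motions, hence factors through the rigidity matrix; octahedra /
bipyramids / face-sharing unions: `octahedronDiagonal_holds`, `bipyramidAxis_holds`,
`octahedronAbsorption_holds` are kernel-checked in `SketchIdeator1`) and Cauchy–Schwarz with
tabulated absorption constants; beyond `R₂ ≈ 8–9` use the additive path/Poincaré bound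
`≤ (10/R₂³ + 17/R₂⁴)·strain` (`ZLattice.summable_norm_sub_inv_pow`).  Float optimum at the worst
datum: a discount `0.15` in `φ`-units suffices for everything beyond `3a` (triage r1-3 §tauR), i.e.
`3.3×` room for the cluster losses; the NN bar framework of hcp has no finitely supported flex. -/
def TailBound : Prop :=
  ∀ (t : Fin 2 → E3) (A : E3 →L[ℝ] E3), Adm₀ A → Inner₀ t A →
    ∀ w : Label → E3, (Function.support w).Finite →
      -((1 / 4 : ℝ) * barForm nnStencil t A w) - (1 / 50 : ℝ) * strainForm nnStencil w ≤
        farForm nearStencil t A w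

/-- **S4 — FOURIER-FREE SOS CERTIFICATES ON THE REDUCED WINDOW (size XL, load-bearing).**  For some
level `κ > 1/50`, at EVERY admissible datum with `A` symmetric positive (the 9-dimensional window:
principal stretches in `[0.945, 0.995]` × inner shift `|d| ≤ 1/40`) the discounted finite-range
operator `near − ¼ bar − κ strain` is a Gram sum of squares of finite differences with stencil
`nearStencil` (316 directed label bonds, `X ∈ Sym(948)`).  Bet: no PSD-vs-SOS gap at this stencil
(float PSD level available ≈ 0.05–0.07 at the worst datum after the `¼ bar` discount; cell-SDP gap
0–16 % at nine window points, kit j008342; 1-D toy exact; zero long-wave polyconvexity gap, kit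
j012831).  Foreseen layer-2 split (lead, once the vertex data exist as a Lean `def`): (a) rational
certificates `X_v = L_vᵀ L_v` at the vertices `v` of a polytope hugging the pulled-back coefficient
image of the window (kernel identities over `ℚ`, `native_decide`/`norm_num` or an external verified
checker), (b) the enclosure "every window operator dominates a convex combination of vertex
operators in the bondwise-PSD order" (A-pull-back, `(ω, ψ)`-chart, triangle/chord minorants, shift
`σ` as an affine vertex parameter), glued by convexity + bondwise-PSD monotonicity of `SOSRep`. -/
def CertificateOnSymWindow : Prop :=
  ∃ κ : ℝ, 1 / 50 < κ ∧
    ∀ (t : Fin 2 → E3) (A : E3 →L[ℝ] E3), Adm₀ A → Inner₀ t A → SymPos A →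
      SOSRep nearStencil (Qform nearStencil nnStencil κ (1 / 4) t A)

/-! ## The registered stubs (the ONLY sorries of the file) -/

/-- stub S1 (L): transfer / soundness — see `TransferReduction`. -/
theorem stub_transfer : TransferReduction := by
  sorry

/-- stub S2 (M–L): polar normal form — see `PolarReduction`. -/
theorem stub_polar : PolarReduction := by
  sorry

/-- stub S3 (L–XL): rigidity-currency tail — see `TailBound`. -/
theorem stub_tail : TailBound := by
  sorry

/-- stub S4 (XL, hardest): pointwise SOS certificates on the reduced window — see `CertificateOnSymWindow`. -/
theorem stub_cert : CertificateOnSymWindow := by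
  sorry

/-! ## Composition: the stubs imply the crux -/

/-- The four statements compose to the crux inequality on the typed window (modus ponens; no sorry). -/
theorem composition :
    TransferReduction → PolarReduction → TailBound → CertificateOnSymWindow →
      PhononStabilityOn fun t A => Adm₀ A ∧ Inner₀ t A := by
  intro htransfer hpolar htail hcert
  obtain ⟨κ, hκ, hc⟩ := hcert
  exact htransfer κ (1 / 4) (1 / 50) hκ (hpolar κ (1 / 4) hc) htail

/-- **The line concludes the crux BY NAME**: the registered stubs fed into `composition` and the
landed mirror `phononStability_iff_on`; no sorry of its own (its axioms are the four stubs'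
`sorryAx` and nothing else), so it becomes the crux proof the moment the stubs land. -/
theorem PhononStability_of :
    Summit.AtomisticToContinuum.Crystallization.Theses.ExcessDecayLiouville.PhononStability :=
  phononStability_iff_on.mpr (composition stub_transfer stub_polar stub_tail stub_cert)

/-! ## Disproof obligations (landed Negative lemmas): both hypotheses are kept by every stub -/

/-- `Adm` is load-bearing (landed): the stubs quantify over `Adm₀ A ∧ Inner₀ t A` only. -/
example : ¬ PhononStabilityOn fun t A => Inner₀ t A := phononStability_false_without_Adm

/-- `Inner` is load-bearing (landed): idem. -/
example : ¬ PhononStabilityOn fun _ A => Adm₀ A := phononStability_false_without_Inner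

end Summit.AtomisticToContinuum.Crystallization.Cruxes.PhononStability.FourierFreeSosCertificate

end
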